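import Summits.Ventures.LatticeQCDFlow.Exactness.FlowSamplerWeightBlindObservables
import Summits.Ventures.LatticeQCDFlow.Exactness.FlowSamplerMeanInverseAcceptanceKish
import HarnessLib

/-!
# Weight-blind observables, II: `1/κ − ½ ≤ τ_int ≤ 2/κ − ½`, `σ²_RW = Var/κ` exactly, and
# `(2 − κ)·σ²_RW ≤ σ²_chain ≤ (4 − κ)·σ²_RW` — the chain and reweighting agree within a factor four

HONEST FRAMING: exact (Metropolis-corrected) sampling algorithms for lattice gauge theory;
figures of merit are autocorrelation/cost numbers at stated couplings and volumes; no
continuum-physics claim.  (SCALAR calibration rung S0-A: not a gauge result.)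

Venture `LatticeQCDFlow` (cell pub-lqcd), topic `Exactness`; FANOUT row 2 (`s0-phi4`, FLOW arm).
NEW WORK of the cell, sequel of `FlowSamplerWeightBlindObservables` (same session): there, for a
bounded observable `g` independent of the level statistic `ℓ` through which the weight factors
(`b = β ∘ ℓ`) and centred under the model, the exact flow sampler acts diagonally and
`τ_int(g) = ½ + (∫ w r/(1−r))/Z = E_π[1/ρ] − ½`.  Here the Kish fraction `κ = Z²/W₂` (`W₂ = ∫ b w < ∞`)
pins both estimators on this class (nothing is cited as a fact; rows 3/8's FINITE product-space
statements `Scoring/IMHWeightBlindTau*` NAMED as the precedent):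
the tree's pointwise pinning `b/Z ≤ 1/ρ ≤ (W₂ + bZ)/Z²` (`rejOdds_ge`, `one_sub_rejCurve_ge`)
integrates to `1/κ ≤ E_π[1/ρ] ≤ 2/κ`; independence gives `σ²_RW(g) = E_π[(b/Z)g²] = Var_π(g)/κ`
EXACTLY; so `σ²_chain = 2τ_int Var ∈ [(2/κ − 1)Var, (4/κ − 1)Var] = [(2 − κ)σ²_RW, (4 − κ)σ²_RW]`.

## What is proved (setting of the parent file; `W₂ < ∞`)

* (from `FlowSamplerMeanInverseAcceptanceKish.weight_odds_bounds`, any flow with `W₂ < ∞`: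
  `W₂/Z − Z ≤ ∫ w r/(1 − r) ≤ 2W₂/Z − Z`, i.e. `1/κ ≤ E_π[1/ρ] ≤ 2/κ`);
* **`tauInt_weightBlind_mem_Icc`** — `1/κ − ½ ≤ τ_int(g) ≤ 2/κ − ½` for every weight-blind bounded `g`
  with `∫ g² q > 0`;
* **`reweightVar_weightBlind_eq`** — `Z⁻² ∫ g² b w = ((∫ g² w)/Z)·(W₂/Z²)` (`σ²_RW = Var/κ`);
* **`chainVar_weightBlind_bounds`** — `(2 − Z²/W₂)·σ²_RW ≤ 2 τ_int(g)·(∫ g² w)/Z ≤ (4 − Z²/W₂)·σ²_RW`.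

Reading for S0-A (no numerics implied): on the weight-blind class the two figures of merit of the
cell's fitness — `τ_int`-per-cost and ESS-per-cost — certify each other within explicit constants,
and the accept/reject step costs between `2 − κ` and `4 − κ` reweighting variances; the unbounded
discrepancies of `FlowSamplerVsReweightingWitness` / `FlowSamplerKishFractionScope` need observables
correlated with the weight.  NOT CLAIMED: weight-blindness of any lattice observable under a trained
flow; unbounded `g`; values for any run.
-/

namespace Summit.Ventures.LatticeQCDFlow.Exactness

open Real MeasureTheory ProbabilityTheory Filter Finset Set Topology
open Summit.Ventures.LatticeQCDFlow.Scoring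

section General

variable {X : Type*} [MeasurableSpace X] {μ : Measure X} [SFinite μ] {w q : X → ℝ}
  {L : Type*} [MeasurableSpace L] {ℓ : X → L} {β : L → ℝ}

/-! ## §4 Under `W₂ < ∞`: `1/κ − ½ ≤ τ_int ≤ 2/κ − ½`, `σ²_RW = Var/κ`, `σ²_chain/σ²_RW ∈ [2 − κ, 4 − κ]` -/

/-- **`1/κ − ½ ≤ τ_int(g) ≤ 2/κ − ½` FOR EVERY WEIGHT-BLIND BOUNDED OBSERVABLE** under `W₂ < ∞`
(`κ = Z²/W₂`): the chain decorrelates such observables in about `1/κ` proposals, within a factor two,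
whatever the flow (general-space form of row 3's finite `blind_tauInt_mem_Icc_essFrac`). -/
theorem tauInt_weightBlind_mem_Icc (hw0 : ∀ t, 0 < w t) (hwm : Measurable w) (hwi : Integrable w μ)
    (hq0 : ∀ t, 0 < q t) (hqm : Measurable q) (hqi : Integrable q μ) (hq1 : ∫ z, q z ∂μ = 1)
    (hW₂ : Integrable (fun x => w x / q x * w x) μ)
    (hℓ : Measurable ℓ) (hβm : Measurable β) (hb : ∀ x, w x / q x = β (ℓ x)) {g : X → ℝ}
    (hgm : Measurable g) {B : ℝ} (hgb : ∀ t, |g t| ≤ B)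
    (hind : IndepFun g ℓ (μ.withDensity fun z => ENNReal.ofReal (q z)))
    (hg0 : ∫ x, g x * q x ∂μ = 0) (hP : 0 < ∫ x, g x ^ 2 * q x ∂μ) :
    (∫ x, w x / q x * w x ∂μ) / (∫ t, w t ∂μ) ^ 2 - 1 / 2
      ≤ tauInt (fun k => (∫ t, g t * ((imhOp μ w q)^[k] g) t * w t ∂μ) / ∫ t, g t ^ 2 * w t ∂μ) ∧
    tauInt (fun k => (∫ t, g t * ((imhOp μ w q)^[k] g) t * w t ∂μ) / ∫ t, g t ^ 2 * w t ∂μ)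
      ≤ 2 * (∫ x, w x / q x * w x ∂μ) / (∫ t, w t ∂μ) ^ 2 - 1 / 2 := by
  obtain ⟨hS, hlo, hhi⟩ := weight_odds_bounds hw0 hwm hwi hq0 hqm hqi hq1 hW₂
  obtain ⟨-, hτ⟩ := tauInt_weightBlind_eq hw0 hwm hwi hq0 hqm hqi hq1 hℓ hβm hb hgm hgb hind hg0 hP hS
  rw [hτ]
  set Z : ℝ := ∫ t, w t ∂μ
  set W : ℝ := ∫ x, w x / q x * w x ∂μ
  set S : ℝ := ∫ t, w t * ((∫ t', (1 - imhAcceptQ w q t t') * q t' ∂μ)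
      / (1 - ∫ t', (1 - imhAcceptQ w q t t') * q t' ∂μ)) ∂μ
  have hZ : 0 < Z := integral_pos_of_pos hw0 hwi hq1
  constructor
  · have h : (W / Z - Z) / Z ≤ S / Z := div_le_div_of_nonneg_right hlo hZ.le
    have e : (W / Z - Z) / Z = W / Z ^ 2 - 1 := by field_simp
    linarith
  · have h : S / Z ≤ (2 * W / Z - Z) / Z := div_le_div_of_nonneg_right hhi hZ.le
    have e : (2 * W / Z - Z) / Z = 2 * W / Z ^ 2 - 1 := by field_simp
    linarith

/-- **`σ²_RW(g) = Var_π(g)/κ` EXACTLY for a weight-blind bounded observable**: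
`Z⁻² ∫ g² b w = ((∫ g² w)/Z) · (W₂/Z²)` (`b w = β(ℓ)² q`, independence). -/
theorem reweightVar_weightBlind_eq (hw0 : ∀ t, 0 < w t) (hwm : Measurable w) (hwi : Integrable w μ)
    (hq0 : ∀ t, 0 < q t) (hqm : Measurable q) (hqi : Integrable q μ) (hq1 : ∫ z, q z ∂μ = 1)
    (hℓ : Measurable ℓ) (hβm : Measurable β) (hb : ∀ x, w x / q x = β (ℓ x)) {g : X → ℝ}
    (hgm : Measurable g) {B : ℝ} (hgb : ∀ t, |g t| ≤ B)
    (hind : IndepFun g ℓ (μ.withDensity fun z => ENNReal.ofReal (q z)))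
    (hg0 : ∫ x, g x * q x ∂μ = 0) :
    (∫ t, g t ^ 2 * (w t / q t * w t) ∂μ) / (∫ t, w t ∂μ) ^ 2
      = ((∫ t, g t ^ 2 * w t ∂μ) / ∫ t, w t ∂μ) * ((∫ x, w x / q x * w x ∂μ) / (∫ t, w t ∂μ) ^ 2) := by
  have hZ : 0 < ∫ t, w t ∂μ := integral_pos_of_pos hw0 hwi hq1
  have hwq : ∀ x, w x = β (ℓ x) * q x := fun x => by
    rw [← hb x, div_mul_cancel₀ _ (hq0 x).ne']
  -- `∫ g² b w = (∫ g² q)(∫ β(ℓ)² q)` and `∫ b w = ∫ β(ℓ)² q`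
  have e1 : (fun t => g t ^ 2 * (w t / q t * w t)) = fun t => g t ^ 2 * (fun l => β l ^ 2) (ℓ t) * q t := by
    funext t; rw [hb t, hwq t]; ring
  have e2 : (fun x => w x / q x * w x) = fun t => (fun l => β l ^ 2) (ℓ t) * q t := by
    funext t; rw [hb t, hwq t]; ring
  rw [e1, integral_sq_levelFun_weightBlind hq0 hqm hℓ hgm hind (hβm.pow_const 2), ← e2,
    sqNorm_weightBlind hw0 hwm hq0 hqm hqi hq1 hℓ hβm hb hgm hgb hind hg0]
  field_simp

/-- **`(2 − κ)·σ²_RW ≤ σ²_chain ≤ (4 − κ)·σ²_RW` FOR EVERY WEIGHT-BLIND BOUNDED OBSERVABLE** under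
`W₂ < ∞` (`κ = Z²/W₂`, `σ²_chain = 2 τ_int(g)·(∫ g² w)/Z`, `σ²_RW = Z⁻² ∫ g² b w`, `∫ g² q > 0`): on the
weight-blind class the exact chain costs between `2 − κ` and `4 − κ` reweighting variances per draw. -/
theorem chainVar_weightBlind_bounds (hw0 : ∀ t, 0 < w t) (hwm : Measurable w) (hwi : Integrable w μ)
    (hq0 : ∀ t, 0 < q t) (hqm : Measurable q) (hqi : Integrable q μ) (hq1 : ∫ z, q z ∂μ = 1)
    (hW₂ : Integrable (fun x => w x / q x * w x) μ)
    (hℓ : Measurable ℓ) (hβm : Measurable β) (hb : ∀ x, w x / q x = β (ℓ x)) {g : X → ℝ}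
    (hgm : Measurable g) {B : ℝ} (hgb : ∀ t, |g t| ≤ B)
    (hind : IndepFun g ℓ (μ.withDensity fun z => ENNReal.ofReal (q z)))
    (hg0 : ∫ x, g x * q x ∂μ = 0) (hP : 0 < ∫ x, g x ^ 2 * q x ∂μ) :
    (2 - (∫ t, w t ∂μ) ^ 2 / ∫ x, w x / q x * w x ∂μ)
        * ((∫ t, g t ^ 2 * (w t / q t * w t) ∂μ) / (∫ t, w t ∂μ) ^ 2)
      ≤ 2 * tauInt (fun k => (∫ t, g t * ((imhOp μ w q)^[k] g) t * w t ∂μ) / ∫ t, g t ^ 2 * w t ∂μ)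
          * ((∫ t, g t ^ 2 * w t ∂μ) / ∫ t, w t ∂μ) ∧
    2 * tauInt (fun k => (∫ t, g t * ((imhOp μ w q)^[k] g) t * w t ∂μ) / ∫ t, g t ^ 2 * w t ∂μ)
          * ((∫ t, g t ^ 2 * w t ∂μ) / ∫ t, w t ∂μ)
      ≤ (4 - (∫ t, w t ∂μ) ^ 2 / ∫ x, w x / q x * w x ∂μ)
        * ((∫ t, g t ^ 2 * (w t / q t * w t) ∂μ) / (∫ t, w t ∂μ) ^ 2) := by
  obtain ⟨hlo, hhi⟩ := tauInt_weightBlind_mem_Icc hw0 hwm hwi hq0 hqm hqi hq1 hW₂ hℓ hβm hb hgm hgb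
    hind hg0 hP
  rw [reweightVar_weightBlind_eq hw0 hwm hwi hq0 hqm hqi hq1 hℓ hβm hb hgm hgb hind hg0,
    sqNorm_weightBlind hw0 hwm hq0 hqm hqi hq1 hℓ hβm hb hgm hgb hind hg0]
  rw [sqNorm_weightBlind hw0 hwm hq0 hqm hqi hq1 hℓ hβm hb hgm hgb hind hg0] at hlo hhi
  set Z : ℝ := ∫ t, w t ∂μ with hZdef
  set W : ℝ := ∫ x, w x / q x * w x ∂μ with hWdef
  set V : ℝ := ∫ x, g x ^ 2 * q x ∂μ with hVdef
  set τ := tauInt (fun k => (∫ t, g t * ((imhOp μ w q)^[k] g) t * w t ∂μ) / (V * Z)) with hτ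
  have hZ : 0 < Z := integral_pos_of_pos hw0 hwi hq1
  -- `W > 0`: it dominates `Z²/1`… directly: the integrand `b w` is positive
  have hW : 0 < W := integral_pos_of_pos (fun x => mul_pos (div_pos (hw0 x) (hq0 x)) (hw0 x)) hW₂ hq1
  have eVZ : V * Z / Z = V := by field_simp
  rw [eVZ]
  constructor
  · -- `(2 − Z²/W) · V · W/Z² = (2W/Z² − 1) V ≤ 2 τ V`
    have e : (2 - Z ^ 2 / W) * (V * (W / Z ^ 2)) = 2 * (W / Z ^ 2 - 1 / 2) * V := by
      field_simp
    rw [e]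
    nlinarith [hlo, hP]
  · have e : (4 - Z ^ 2 / W) * (V * (W / Z ^ 2)) = 2 * (2 * W / Z ^ 2 - 1 / 2) * V := by
      field_simp
      ring
    rw [e]
    nlinarith [hhi, hP]

end General

end Summit.Ventures.LatticeQCDFlow.Exactness
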